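import Summits.ValiantsHypothesis.ValiantsHypothesis.Theorems.DefinabilityGapQuadraticReading
import HarnessLib

/-!
# DefinabilityGap — the QUADRATIC RUNG of the planted Kabanets–Impagliazzo permanent generator (unconditional)

Route `route-ValiantsHypothesis-DefinabilityGap` (decomp-valiant cycle 1, lens 5: hardness–randomness / PIT axis),
supporting the bet item `KIAnnihilatorCHDefinable` (stmt-ValiantsHypothesis-23444: the degree profile of the ideal of
`G_m`) and the hitting residual `KIPlantedHitting` (stmt-ValiantsHypothesis-23547).

MAIN THEOREM `kiPer_hits_quadratic`: for every `m ≥ 3`, NO nonzero polynomial of total degree `≤ 2` in the `q(m)³`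
coordinate variables annihilates `G_m = (per_m(y|S_c))_{c ∈ 𝔽_q³}`. The tree's low-degree rung `kiPer_hits_lowDegree`
needs `2k < m`, so at `k = 2` it is silent for `m = 3, 4`; this file closes that gap (the numeric instrument T-K2ch-deg2
of the route folder, `v4/instrument-sym-m3.md`, observed it at `m = 3`). Sharp: false at `m = 2` (80 linear annihilators).

Proof (unique reading, in the original coordinates). For a pair of coordinates `(c, c')` use the witness exponent
`W = μ(c, id) + μ(c', rot)`: the diagonal pattern of block `c` plus the pattern of the cyclic shift `rot = finRotate m`
in block `c'`. The matrix positions of `id` and `rot` are disjoint and form ONE `2m`-cycle, so a permutation using only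
positions of `id ∪ rot` is `id` or `rot` (`perm_eq_one_or_finRotate`, via `isCycle_finRotate_of_le`). Hence if a
product of a monomial of `G_m(d)` and a monomial of `G_m(d')` has exponent `W`, the two patterns are `{id, rot}` and
each block shares `m ≥ 3` cells with `S_c` resp. `S_{c'}`, forcing `{d, d'} = {c, c'}` (two quadratic curves share `≤ 2`
cells, `quadDesign_isNWDesign`). So the coefficient of `y^W` in `D ∘ G_m` is `D`'s coefficient at `z_c z_{c'}` times
`1` (or `2` if `c = c'`); lower-degree monomials of `D` do not reach `y`-degree `2m` (`G_m(d)` is homogeneous of degree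
`m`). If `D` has no degree-2 monomial the affine rung applies. 0 sorry.

Part 2 of 2: §4 coefficient extraction at the witness exponent and the main theorems `kiPer_hits_quadratic` /
`kiPer_hits_quadratic_eventually`; §§1–3 are in `DefinabilityGapQuadraticReading` (part 1). Source: lens-5 g15 kernel file (sha256 2ea517c7…),
landed by the census prover seat; supports stmt-ValiantsHypothesis-23444 / 23547. 0 sorry; VP ≠ VNP untouched.
-/

set_option linter.dupNamespace false

noncomputable section

open MvPolynomial
open Literature.Computability.AlgebraicComplexity Literature.Computability.MetaComplexity

namespace Summit.ValiantsHypothesis.ValiantsHypothesis.Theorems.DefinabilityGapAffineRung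

section QuadraticRung

variable {m : ℕ}

/-! ## 4. Coefficient extraction at the witness exponent -/

/-- Pairs `{d, d'} ≠ {c, c'}` contribute nothing at `y^{W(c,c')}`. [this file] -/
theorem coeff_quadWitness_mul_eq_zero (hm : 3 ≤ m) {c c' d d' : Fin 3 → Fin (qOf m)}
    (hne : Finsupp.single d 1 + Finsupp.single d' 1 ≠
      (Finsupp.single c 1 + Finsupp.single c' 1 : (Fin 3 → Fin (qOf m)) →₀ ℕ)) :
    coeff (quadWitness m c c') (kiPer m d * kiPer m d') = 0 := by
  classical
  rw [coeff_mul]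
  refine Finset.sum_eq_zero fun x hx => ?_
  by_contra hprod
  obtain ⟨h1, h2⟩ := mul_ne_zero_iff.1 hprod
  obtain ⟨ρ, hρ⟩ := exists_pmono_of_coeff_kiPer_ne_zero h1
  obtain ⟨ρ', hρ'⟩ := exists_pmono_of_coeff_kiPer_ne_zero h2
  have hsum : pmono m d ρ + pmono m d' ρ' = quadWitness m c c' := by
    rw [← hρ, ← hρ']
    exact Finset.HasAntidiagonal.mem_antidiagonal.1 hx
  rcases reading_unique hm hsum with ⟨-, -, rfl, rfl⟩ | ⟨-, -, rfl, rfl⟩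
  · exact hne rfl
  · exact hne (add_comm _ _)

/-- The pair `(c, c')` itself contributes `1` (or `2` on the diagonal) — in any case a nonzero coefficient. [this file] -/
theorem coeff_quadWitness_mul_ne_zero (hm : 3 ≤ m) (c c' : Fin 3 → Fin (qOf m)) :
    coeff (quadWitness m c c') (kiPer m c * kiPer m c') ≠ 0 := by
  classical
  have hm2 : 2 ≤ m := by omega
  rw [coeff_mul]
  set x₀ : ((Fin (qOf m) × Fin (qOf m)) →₀ ℕ) × ((Fin (qOf m) × Fin (qOf m)) →₀ ℕ) :=
    (pmono m c 1, pmono m c' (finRotate m)) with hx₀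
  set x₁ : ((Fin (qOf m) × Fin (qOf m)) →₀ ℕ) × ((Fin (qOf m) × Fin (qOf m)) →₀ ℕ) :=
    (pmono m c (finRotate m), pmono m c' 1) with hx₁
  have hval₀ : coeff x₀.1 (kiPer m c) * coeff x₀.2 (kiPer m c') = 1 := by
    simp only [hx₀, coeff_pmono_kiPer_self, mul_one]
  have hmem₀ : x₀ ∈ Finset.HasAntidiagonal.antidiagonal (quadWitness m c c') :=
    Finset.HasAntidiagonal.mem_antidiagonal.2 rfl
  -- every other nonzero term is `x₁`, and then `c = c'`
  have hothers : ∀ x ∈ Finset.HasAntidiagonal.antidiagonal (quadWitness m c c'), x ≠ x₀ →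
      coeff x.1 (kiPer m c) * coeff x.2 (kiPer m c') ≠ 0 → x = x₁ ∧ c = c' := by
    intro x hx hx0 hprod
    obtain ⟨h1, h2⟩ := mul_ne_zero_iff.1 hprod
    obtain ⟨ρ, hρ⟩ := exists_pmono_of_coeff_kiPer_ne_zero h1
    obtain ⟨ρ', hρ'⟩ := exists_pmono_of_coeff_kiPer_ne_zero h2
    have hsum : pmono m c ρ + pmono m c' ρ' = quadWitness m c c' := by
      rw [← hρ, ← hρ']
      exact Finset.HasAntidiagonal.mem_antidiagonal.1 hx
    rcases reading_unique hm hsum with ⟨rfl, rfl, -, -⟩ | ⟨rfl, rfl, hcc', -⟩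
    · exact absurd (Prod.ext hρ hρ') hx0
    · exact ⟨Prod.ext hρ hρ', hcc'⟩
  by_cases hcc' : c = c'
  · -- diagonal: exactly the two terms `x₀`, `x₁`, each equal to `1`
    have h1rot : ∀ a, (1 : Equiv.Perm (Fin m)) a ≠ finRotate m a := fun a => by
      rw [Equiv.Perm.one_apply]; exact (finRotate_apply_ne hm2 a).symm
    have hne01 : x₀ ≠ x₁ := by
      intro h01
      have h1 : pmono m c 1 = pmono m c (finRotate m) := congrArg Prod.fst h01
      have hs : cellEmb m c ((1 : Equiv.Perm (Fin m)) ⟨0, by omega⟩, ⟨0, by omega⟩) ∈ (pmono m c 1).support :=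
        mem_support_pmono.2 ⟨_, rfl⟩
      have hs' := hs
      rw [h1] at hs'
      exact not_mem_support_pmono_of_ne h1rot hs hs'
    have hval₁ : coeff x₁.1 (kiPer m c) * coeff x₁.2 (kiPer m c') = 1 := by
      simp only [hx₁, coeff_pmono_kiPer_self, mul_one]
    rw [Finset.sum_eq_add x₀ x₁ hne01]
    · rw [hval₀, hval₁]; norm_num
    · intro x hx hx01
      by_contra hprod
      exact hx01.2 (hothers x hx hx01.1 hprod).1
    · intro h; exact absurd hmem₀ h
    · intro h
      exfalso
      apply h
      subst hcc'
      exact Finset.HasAntidiagonal.mem_antidiagonal.2 (add_comm _ _)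
  · rw [Finset.sum_eq_single x₀]
    · rw [hval₀]; exact one_ne_zero
    · intro x hx hx0
      by_contra hprod
      exact hcc' (hothers x hx hx0 hprod).2
    · intro h; exact absurd hmem₀ h

/-- Exponents of degree `≤ 2`: `0`, `e_d`, or `e_d + e_{d'}`. [folklore] -/
theorem finsupp_cases_of_degree_le_two {ι : Type*} (e : ι →₀ ℕ) (he : (e.sum fun _ n => n) ≤ 2) :
    e = 0 ∨ (∃ d, e = Finsupp.single d 1) ∨ ∃ d d', e = Finsupp.single d 1 + Finsupp.single d' 1 := by
  classical
  by_cases h1 : (e.sum fun _ n => n) ≤ 1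
  · rcases BarrierLever.ChowFactor.finsupp_eq_zero_or_single_of_degree_le_one e h1 with rfl | ⟨v, rfl⟩
    · exact Or.inl rfl
    · exact Or.inr (Or.inl ⟨v, rfl⟩)
  · -- degree exactly 2: peel off one unit
    have hne : e ≠ 0 := by
      rintro rfl
      simp at h1
    obtain ⟨d, hd⟩ := Finsupp.support_nonempty_iff.2 hne
    have hle : Finsupp.single d 1 ≤ e := by
      intro i
      by_cases hid : i = d
      · subst hid
        rw [Finsupp.single_eq_same]
        exact Nat.one_le_iff_ne_zero.2 (Finsupp.mem_support_iff.1 hd)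
      · rw [Finsupp.single_eq_of_ne hid]
        exact Nat.zero_le _
    set e' := e - Finsupp.single d 1 with he'
    have hdecomp : e = Finsupp.single d 1 + e' := by
      rw [he', add_comm, tsub_add_cancel_of_le hle]
    have hdeg : (e.sum fun _ n => n) = 1 + e'.sum fun _ n => n := by
      conv_lhs => rw [hdecomp]
      rw [Finsupp.sum_add_index' (fun _ => rfl) (fun _ _ _ => rfl), Finsupp.sum_single_index rfl]
    have h1' : (e'.sum fun _ n => n) ≤ 1 := by omega
    rcases BarrierLever.ChowFactor.finsupp_eq_zero_or_single_of_degree_le_one e' h1' with h0 | ⟨v, hv⟩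
    · exfalso
      rw [h0] at hdeg
      simp at hdeg
      omega
    · exact Or.inr (Or.inr ⟨d, v, by rw [hdecomp, hv]⟩)

/-- `bind₁ f (a·z_d) = a·f d`. [folklore] -/
theorem bind₁_monomial_single_one {σ τ R : Type*} [CommSemiring R] (f : σ → MvPolynomial τ R) (d : σ) (a : R) :
    bind₁ f (monomial (Finsupp.single d 1) a) = C a * f d := by
  rw [← C_mul_X_eq_monomial, map_mul, bind₁_C_right, bind₁_X_right]

/-- `bind₁ f (a·z_d z_{d'}) = a·(f d · f d')`. [folklore] -/
theorem bind₁_monomial_single_add_single {σ τ R : Type*} [CommSemiring R] (f : σ → MvPolynomial τ R)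
    (d d' : σ) (a : R) :
    bind₁ f (monomial (Finsupp.single d 1 + Finsupp.single d' 1) a) = C a * (f d * f d') := by
  rw [monomial_single_add, ← C_mul_X_eq_monomial, map_mul, map_pow, map_mul, bind₁_X_right, bind₁_C_right,
    bind₁_X_right, pow_one, mul_left_comm]

/-- The term of `D ∘ G_m` indexed by `e` at the witness exponent of `(c, c')`. [this file] -/
theorem coeff_quadWitness_term (hm : 3 ≤ m) (c c' : Fin 3 → Fin (qOf m))
    (e : (Fin 3 → Fin (qOf m)) →₀ ℕ) (he : (e.sum fun _ n => n) ≤ 2)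
    (hne : e ≠ Finsupp.single c 1 + Finsupp.single c' 1) (a : ℂ) :
    coeff (quadWitness m c c') (bind₁ (kiPer m) (monomial e a)) = 0 := by
  classical
  have hm2 : 2 ≤ m := by omega
  have hdegW : (quadWitness m c c').degree = m + m := by
    rw [quadWitness, map_add, degree_pmono, degree_pmono]
  rcases finsupp_cases_of_degree_le_two e he with rfl | ⟨d, rfl⟩ | ⟨d, d', rfl⟩
  · rw [← C_apply, bind₁_C_right, coeff_C, if_neg]
    intro h0
    have := congrArg Finsupp.degree h0
    rw [map_zero, hdegW] at this
    omega
  · rw [bind₁_monomial_single_one, coeff_C_mul, (kiPer_isHomogeneous d).coeff_eq_zero, mul_zero]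
    rw [hdegW]; omega
  · rw [bind₁_monomial_single_add_single, coeff_C_mul, coeff_quadWitness_mul_eq_zero hm hne, mul_zero]

/-- **Coefficient extraction**: for `D` of total degree `≤ 2`, the coefficient of `y^{W(c,c')}` in `D ∘ G_m` is
`D`'s coefficient at `z_c z_{c'}` times a nonzero integer. [this file] -/
theorem coeff_quadWitness_bind₁_kiPer (hm : 3 ≤ m) (D : MvPolynomial (Fin 3 → Fin (qOf m)) ℂ)
    (hdeg : D.totalDegree ≤ 2) (c c' : Fin 3 → Fin (qOf m)) :
    coeff (quadWitness m c c') (bind₁ (kiPer m) D) =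
      coeff (Finsupp.single c 1 + Finsupp.single c' 1) D *
        coeff (quadWitness m c c') (kiPer m c * kiPer m c') := by
  classical
  conv_lhs => rw [D.as_sum, map_sum, coeff_sum]
  rw [Finset.sum_eq_single (Finsupp.single c 1 + Finsupp.single c' 1)]
  · rw [bind₁_monomial_single_add_single, coeff_C_mul]
  · intro e he hne
    exact coeff_quadWitness_term hm c c' e ((le_totalDegree he).trans hdeg) hne _
  · intro h0
    rw [notMem_support_iff.1 h0, monomial_zero, map_zero, coeff_zero]

/-- **The quadratic rung (unconditional, kernel): for `m ≥ 3` no nonzero polynomial of total degree `≤ 2` — in all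
`q(m)³` coordinate variables — annihilates the KI-planted permanent map `G_m`.** [this file] -/
theorem kiPer_hits_quadratic (hm : 3 ≤ m) (D : MvPolynomial (Fin 3 → Fin (qOf m)) ℂ) (hD : D ≠ 0)
    (hdeg : D.totalDegree ≤ 2) : bind₁ (kiPer m) D ≠ 0 := by
  classical
  by_cases h2 : ∃ e ∈ D.support, ¬ (e.sum fun _ n => n) ≤ 1
  · obtain ⟨e, he, he1⟩ := h2
    have he2 : (e.sum fun _ n => n) ≤ 2 := (le_totalDegree he).trans hdeg
    obtain ⟨c, c', rfl⟩ : ∃ c c', e = Finsupp.single c 1 + Finsupp.single c' 1 := by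
      rcases finsupp_cases_of_degree_le_two e he2 with rfl | ⟨d, rfl⟩ | ⟨d, d', rfl⟩
      · simp at he1
      · rw [Finsupp.sum_single_index rfl] at he1; omega
      · exact ⟨d, d', rfl⟩
    intro h0
    have h1 := coeff_quadWitness_bind₁_kiPer hm D hdeg c c'
    rw [h0, coeff_zero] at h1
    exact mul_ne_zero (mem_support_iff.1 he) (coeff_quadWitness_mul_ne_zero hm c c') h1.symm
  · push Not at h2
    have hdeg1 : D.totalDegree ≤ 1 := by
      rw [totalDegree]
      exact Finset.sup_le fun e he => h2 e he
    exact kiPer_hits_affine hm D hD hdeg1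

/-- Eventual / initial-degree form: for all `m ≥ 3` the ideal of `G_m` has no elements of degree `≤ 2`, i.e. its
initial degree is `≥ 3` (the low-degree rung gives only `≥ ⌈m/2⌉`, which is `2` at `m = 3, 4`). [this file] -/
theorem kiPer_hits_quadratic_eventually : ∀ m, 3 ≤ m →
    ∀ D : MvPolynomial (Fin 3 → Fin (qOf m)) ℂ, D ≠ 0 → D.totalDegree ≤ 2 → bind₁ (kiPer m) D ≠ 0 :=
  fun _ hm D hD hdeg => kiPer_hits_quadratic hm D hD hdeg

end QuadraticRung

end Summit.ValiantsHypothesis.ValiantsHypothesis.Theorems.DefinabilityGapAffineRung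

end
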